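import Literature.AlgebraicGeometry.Resolution.QuadraticTransformWeakTransform
import Literature.RingTheory.RegularLocalRing.QuotientDVR
import Mathlib.RingTheory.OrderOfVanishing.Noetherian
import Mathlib.RingTheory.Length
import HarnessLib

/-!
# [OURS · L1 W4.6 rung (ii) ladder support] LOCAL INTERSECTION NUMBERS OF TWO BRANCHES AT A POINT OF A REGULAR
# SURFACE — the colength `i(f, g) = λ_R(R/(f, g))` in a two-dimensional regular local ring (brick for the `d = 2`
# rung (ii-2), design point (3) of the holder's RUNG-II-2-PLAN: «intersection numbers i_x(C, C′)»)

Cell res-hironaka, LADDER-RESOLUTION rung L (D-0089), slot W4.6, rung (ii) dimension ladder; seat res-L1-s46-pv-10 =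
res-D-pv-047, filed as SUPPORT for the `d = 2` rung (holder res-L1-s46-pv-11 = res-D-pv-049, GO 2026-08-27T05:30:58Z,
wish-list (I1)–(I2); the blow-up half (I3)–(I5) is the sibling file `…GammaFreeGlobalIntersectionBlowup.lean`). Host route
MarkedTransfer, host item `HypersurfaceOrderReductionDimLeThree` (stmt-ResolutionOfSingularities-16156), `--kind proof
--supports … --as helper`. Everything here is classical commutative algebra of a two-dimensional regular local ring
`(R, 𝔪)` (Matsumura Thms. 11.2, 14.2, 14.3, 20.3; the name "intersection number / multiplicity of two curves at a point of
a surface" as in Hartshorne Ch. V §1 (p. 357, `(C.D)_P = length 𝒪_{P,X}/(f, g)`) and Ex. V.3.2);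
nothing is a statement of the manuscript under adjudication; no typed `Hironaka2017` candidate and no unproved named fact
enters. DEF-FREE: the intersection number of the branches `f = 0`, `g = 0` at the closed point is written out as
`Module.length R (R ⧸ Ideal.span {f, g})` (an `ℕ∞`). AI-written; weaker than expert review.

## What is proved (`R` a regular local ring with `ringKrullDim R = 2` where marked)

* `length_quotient_span_pair_eq_ord` (any commutative ring) — `λ_R(R/(f, g)) = ord_{R/(f)}(ḡ)`, Mathlib's order of
  vanishing `Ring.ord` of the class of `g` on the branch ring `R/(f)`.
* `length_quotient_eq_one_iff`, `one_le_length_quotient_iff` (any local ring) — `λ(R/I) = 1 ↔ I = 𝔪`,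
  `1 ≤ λ(R/I) ↔ I ⊆ 𝔪`; specialised: `length_quotient_span_pair_eq_one_iff` **(I2) `i(f,g) = 1 ↔ (f, g) = 𝔪`**
  (transversality), `one_le_length_quotient_span_pair_iff`.
* `isDiscreteValuationRing_quotient_span_singleton`, `irreducible_mk_of_span_pair` — for a REGULAR branch
  `f ∈ 𝔪 ∖ 𝔪²` the branch ring `R/(f)` is a discrete valuation ring, and for `𝔪 = (x, f)` the class `x̄` is a
  uniformizer.
* **(I1)** `length_quotient_span_pair_eq_top_iff` — `i(f, g) = ∞ ↔ f ∣ g` (`f` regular); for ARBITRARY branches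
  `length_quotient_span_pair_ne_top_of_isRelPrime` — relatively prime `p, q` (e.g. generators of two distinct
  height-one primes, `isRelPrime_of_prime_of_not_associated`) have `i(p, q) < ∞` (`(p, q)` is `𝔪`-primary, tree
  `exists_pow_maximalIdeal_le_span_pair`, and `R/𝔪ᴺ` has finite length, `length_quotient_pow_maximalIdeal_ne_top`).
* `length_quotient_span_pair_unit_mul_pow_add` — **the value**: `i(f, u xⁿ + f h) = n` for `𝔪 = (x, f)`, `u` a unit;
  `exists_eq_unit_mul_pow_add_mul` — **normal form** of any `g` with `f ∤ g`: `g = u xⁿ + f h`, `u` a unit,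
  `n = i(f, g)`; `length_quotient_span_pair_mul` — additivity `i(f, g₁ g₂) = i(f, g₁) + i(f, g₂)`.

References: H. Matsumura, *Commutative Ring Theory* (1986), Thms. 11.2, 14.2, 14.3, 20.3 [Matsumura1987];
R. Hartshorne, *Algebraic Geometry* (1977), Ch. V §1 (local intersection multiplicity as a length), Rem. V.3.5.2,
Ex. V.3.2 [Hartshorne1977];
tree `Resolution/RegularLocalRingsQuotient` (`prime_of_not_mem_sq`, `quotient_span_singleton`),
`Resolution/QuadraticTransformsUFD` (`exists_pow_maximalIdeal_le_span_pair`), `Resolution/InitialFormLinearFactors`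
(`add_mul_not_mem_sq`), `Literature/RingTheory/RegularLocalRing/QuotientDVR` (`isDiscreteValuationRing_of_ringKrullDim_eq_one`);
Mathlib `RingTheory/OrderOfVanishing` (`Ring.ord`, `Ring.ord_eq_addVal`), `RingTheory/DiscreteValuationRing/Basic`.
H. Hironaka, ms. 2017-03-23 — scope only (the `d = 2` rung of the campaign), under adjudication, not cited as fact.
[Hironaka2017]
-/

noncomputable section

set_option linter.dupNamespace false

open IsLocalRing

namespace Summit.ResolutionOfSingularities.ResolutionOfSingularities.Theorems

namespace CampaignW46

open Literature.AlgebraicGeometry.Resolution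

universe u

/-! ## The colength of `(f, g)` is the order of vanishing of `g` on the branch `f = 0` -/

section AnyRing

variable {R : Type u} [CommRing R]

/-- **The colength of `(f, g)` is the order of vanishing of `g` on the branch `f = 0`**:
`λ_R(R/(f, g)) = λ_{R/(f)}((R/(f))/(ḡ)) = ord_{R/(f)}(ḡ)` (`R/(f, g) ≅ (R/(f))/(ḡ)`, and lengths over `R` and over
its quotient `R/(f)` agree). Valid in any commutative ring. [folklore] -/
theorem length_quotient_span_pair_eq_ord (f g : R) :
    Module.length R (R ⧸ Ideal.span {f, g}) =
      Ring.ord (R ⧸ Ideal.span {f}) (Ideal.Quotient.mk (Ideal.span {f}) g) := by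
  set I : Ideal R := Ideal.span {f} with hI
  have hsurj : Function.Surjective (algebraMap R (R ⧸ I)) := by
    rw [Ideal.Quotient.algebraMap_eq]; exact Ideal.Quotient.mk_surjective
  rw [Ring.ord, ← Module.length_eq_of_surjective (S := R) (R := R ⧸ I) hsurj]
  have h1 : (Ideal.span {g}).map (Ideal.Quotient.mkₐ R I) =
      Ideal.span {Ideal.Quotient.mk I g} := by
    rw [Ideal.map_span, Set.image_singleton]; rfl
  have h2 : I ⊔ Ideal.span {g} = Ideal.span {f, g} := by
    rw [hI, Ideal.span_insert]
  have e : ((R ⧸ I) ⧸ Ideal.span {Ideal.Quotient.mk I g}) ≃ₐ[R] R ⧸ Ideal.span {f, g} :=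
    ((Ideal.quotientEquivAlgOfEq R h1).symm.trans (DoubleQuot.quotQuotEquivQuotSupₐ R I _)).trans
      (Ideal.quotientEquivAlgOfEq R h2)
  exact e.toLinearEquiv.length_eq.symm

/-- In a local ring: `λ(R/I) = 1` iff `I = 𝔪` (a cyclic module is simple iff it is the residue field).
[folklore] -/
theorem length_quotient_eq_one_iff [IsLocalRing R] (I : Ideal R) :
    Module.length R (R ⧸ I) = 1 ↔ I = maximalIdeal R := by
  rw [Module.length_eq_one_iff, isSimpleModule_iff_isCoatom, ← Ideal.isMaximal_def]
  exact ⟨fun h => IsLocalRing.eq_maximalIdeal h, fun h => h ▸ IsLocalRing.maximalIdeal.isMaximal R⟩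

/-- In a local ring: `λ(R/I) ≥ 1` iff `I ⊆ 𝔪` (iff `R/I ≠ 0`). [folklore] -/
theorem one_le_length_quotient_iff [IsLocalRing R] (I : Ideal R) :
    1 ≤ Module.length R (R ⧸ I) ↔ I ≤ maximalIdeal R := by
  rw [Order.one_le_iff_ne_zero, Ne, Module.length_eq_zero_iff, Ideal.Quotient.subsingleton_iff]
  exact ⟨fun h => IsLocalRing.le_maximalIdeal h,
    fun h htop => (maximalIdeal.isMaximal R).ne_top (top_le_iff.mp (htop ▸ h))⟩

end AnyRing

/-! ## The branch `f = 0` of a two-dimensional regular local ring is a discrete valuation ring -/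

section Branch

variable {R : Type u} [CommRing R] [IsRegularLocalRing R]

/-- For `𝔪 = (x, f)` in a two-dimensional regular local ring: `x ∉ 𝔪²` (abstract-ring form of the tree's
`fst_not_mem_sq`). [folklore] -/
theorem not_mem_sq_of_span_pair (hdim : ringKrullDim R = 2) {x f : R}
    (hm : maximalIdeal R = Ideal.span {x, f}) : x ∉ maximalIdeal R ^ 2 := by
  have := add_mul_not_mem_sq hdim hm 0
  rwa [zero_mul, add_zero] at this

/-- For `𝔪 = (x, f)`: `f ∉ 𝔪²`. [folklore] -/
theorem not_mem_sq_of_span_pair' (hdim : ringKrullDim R = 2) {x f : R}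
    (hm : maximalIdeal R = Ideal.span {x, f}) : f ∉ maximalIdeal R ^ 2 :=
  not_mem_sq_of_span_pair hdim (hm.trans Ideal.span_pair_comm)

/-- For `f ∈ 𝔪 ∖ 𝔪²` of a regular local ring, `(f)` is a prime ideal (Matsumura 14.3: `f` is a prime
element). [cite: Matsumura1987, Thm. 14.3] -/
theorem isPrime_span_singleton_of_not_mem_sq {f : R} (hf : f ∈ maximalIdeal R)
    (hf2 : f ∉ maximalIdeal R ^ 2) : (Ideal.span {f}).IsPrime := by
  have hf0 : f ≠ 0 := by rintro rfl; exact hf2 (Ideal.zero_mem _)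
  exact (Ideal.span_singleton_prime hf0).mpr (IsRegularLocalRing.prime_of_not_mem_sq hf hf2)

/-- **The branch ring `R/(f)` of a regular parameter `f ∈ 𝔪 ∖ 𝔪²` of a two-dimensional regular local
ring is a discrete valuation ring** (regular local of dimension one). [cite: Matsumura1987, Thm. 14.2] -/
theorem isDiscreteValuationRing_quotient_span_singleton (hdim : ringKrullDim R = 2) {f : R}
    (hf : f ∈ maximalIdeal R) (hf2 : f ∉ maximalIdeal R ^ 2) :
    haveI := isPrime_span_singleton_of_not_mem_sq hf hf2
    IsDiscreteValuationRing (R ⧸ Ideal.span {f}) := by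
  haveI := isPrime_span_singleton_of_not_mem_sq hf hf2
  obtain ⟨hreg, hd⟩ := IsRegularLocalRing.quotient_span_singleton hf hf2
  have hd1 : ringKrullDim (R ⧸ Ideal.span {f}) = 1 := by
    obtain ⟨n, hn⟩ := exists_nat_cast_eq_ringKrullDim (R := R ⧸ Ideal.span {f})
    rw [hdim, hn] at hd
    rw [hn]
    have h2 : n + 1 = 2 := by
      have : ((n + 1 : ℕ) : WithBot ℕ∞) = ((2 : ℕ) : WithBot ℕ∞) := by push_cast; exact hd
      exact_mod_cast this
    have h1 : n = 1 := by omega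
    subst h1
    rfl
  exact Literature.RingTheory.RegularLocalRing.isDiscreteValuationRing_of_ringKrullDim_eq_one hd1

/-- With `𝔪 = (x, f)`: **the class of `x` is a uniformizer of the branch ring `R/(f)`** (its maximal
ideal is the image `(x̄, f̄) = (x̄)` of `𝔪`). [folklore] -/
theorem irreducible_mk_of_span_pair (hdim : ringKrullDim R = 2) {x f : R}
    (hm : maximalIdeal R = Ideal.span {x, f}) :
    Irreducible (Ideal.Quotient.mk (Ideal.span {f}) x) := by
  have hf : f ∈ maximalIdeal R := hm ▸ Ideal.subset_span (by simp)
  have hf2 : f ∉ maximalIdeal R ^ 2 := not_mem_sq_of_span_pair' hdim hm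
  haveI := isPrime_span_singleton_of_not_mem_sq hf hf2
  haveI := isDiscreteValuationRing_quotient_span_singleton hdim hf hf2
  haveI : Nontrivial (R ⧸ Ideal.span {f}) := inferInstance
  rw [IsDiscreteValuationRing.irreducible_iff_uniformizer, maximalIdeal_quotient_eq_map (Ideal.span {f}),
    hm, Ideal.map_span, Set.image_insert_eq, Set.image_singleton,
    Ideal.Quotient.eq_zero_iff_mem.mpr (Ideal.mem_span_singleton_self f)]
  -- `(x̄, 0) = (x̄)`
  rw [Ideal.span_insert, Ideal.span_singleton_eq_bot.mpr rfl, sup_bot_eq]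

end Branch

/-! ## Local intersection numbers `i(f, g) = λ(R/(f, g))` with a regular branch `f` -/

section IntersectionNumber

variable {R : Type u} [CommRing R] [IsRegularLocalRing R]

/-- **(I1) finiteness.** For a regular branch `f ∈ 𝔪 ∖ 𝔪²` of a two-dimensional regular local ring
and any `g`: `λ(R/(f, g)) = ∞ ↔ f ∣ g` — the intersection number with a distinct branch is finite.
[folklore] -/
theorem length_quotient_span_pair_eq_top_iff (hdim : ringKrullDim R = 2) {f : R}
    (hf : f ∈ maximalIdeal R) (hf2 : f ∉ maximalIdeal R ^ 2) (g : R) :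
    Module.length R (R ⧸ Ideal.span {f, g}) = ⊤ ↔ f ∣ g := by
  haveI := isPrime_span_singleton_of_not_mem_sq hf hf2
  haveI := isDiscreteValuationRing_quotient_span_singleton hdim hf hf2
  rw [length_quotient_span_pair_eq_ord, Ring.ord_eq_addVal, IsDiscreteValuationRing.addVal_eq_top_iff,
    Ideal.Quotient.eq_zero_iff_mem, Ideal.mem_span_singleton]

/-- **Additivity in the second branch**: `λ(R/(f, g₁g₂)) = λ(R/(f, g₁)) + λ(R/(f, g₂))` for a regular
branch `f` (the order of vanishing on the discrete valuation ring `R/(f)` is a valuation). [folklore] -/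
theorem length_quotient_span_pair_mul (hdim : ringKrullDim R = 2) {f : R}
    (hf : f ∈ maximalIdeal R) (hf2 : f ∉ maximalIdeal R ^ 2) (g₁ g₂ : R) :
    Module.length R (R ⧸ Ideal.span {f, g₁ * g₂}) =
      Module.length R (R ⧸ Ideal.span {f, g₁}) + Module.length R (R ⧸ Ideal.span {f, g₂}) := by
  haveI := isPrime_span_singleton_of_not_mem_sq hf hf2
  haveI := isDiscreteValuationRing_quotient_span_singleton hdim hf hf2
  simp only [length_quotient_span_pair_eq_ord, Ring.ord_eq_addVal, map_mul,
    IsDiscreteValuationRing.addVal_mul]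

/-- **The value of the intersection number**: with `𝔪 = (x, f)`, a unit `u` and any `h`,
`λ(R/(f, u xⁿ + f h)) = n` (on the branch `R/(f)` the element is `ū x̄ⁿ` and `x̄` is a uniformizer).
[folklore] -/
theorem length_quotient_span_pair_unit_mul_pow_add (hdim : ringKrullDim R = 2) {x f : R}
    (hm : maximalIdeal R = Ideal.span {x, f}) {u : R} (hu : IsUnit u) (n : ℕ) (h : R) :
    Module.length R (R ⧸ Ideal.span {f, u * x ^ n + f * h}) = n := by
  have hf : f ∈ maximalIdeal R := hm ▸ Ideal.subset_span (by simp)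
  have hf2 : f ∉ maximalIdeal R ^ 2 := not_mem_sq_of_span_pair' hdim hm
  haveI := isPrime_span_singleton_of_not_mem_sq hf hf2
  haveI := isDiscreteValuationRing_quotient_span_singleton hdim hf hf2
  have hirr := irreducible_mk_of_span_pair hdim hm
  have hf0 : Ideal.Quotient.mk (Ideal.span {f}) f = 0 :=
    Ideal.Quotient.eq_zero_iff_mem.mpr (Ideal.mem_span_singleton_self f)
  have hu0 : IsDiscreteValuationRing.addVal (R ⧸ Ideal.span {f}) (Ideal.Quotient.mk _ u) = 0 :=
    IsDiscreteValuationRing.addVal_eq_zero_iff.mpr (hu.map _)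
  rw [length_quotient_span_pair_eq_ord, Ring.ord_eq_addVal, map_add, map_mul, map_mul, map_pow, hf0,
    zero_mul, add_zero, IsDiscreteValuationRing.addVal_mul, hu0, zero_add, hirr.addVal_pow]

/-- **Normal form of a second branch**: with `𝔪 = (x, f)` and `f ∤ g`, `g = u xⁿ + f h` with `u` a unit
and `n = λ(R/(f, g))` (lift `ḡ = ū x̄ⁿ` from the discrete valuation ring `R/(f)`; units lift along the
local surjection `R → R/(f)`). [folklore] -/
theorem exists_eq_unit_mul_pow_add_mul (hdim : ringKrullDim R = 2) {x f : R}
    (hm : maximalIdeal R = Ideal.span {x, f}) {g : R} (hfg : ¬ f ∣ g) :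
    ∃ (n : ℕ) (u h : R), IsUnit u ∧ g = u * x ^ n + f * h ∧
      Module.length R (R ⧸ Ideal.span {f, g}) = n := by
  have hf : f ∈ maximalIdeal R := hm ▸ Ideal.subset_span (by simp)
  have hf2 : f ∉ maximalIdeal R ^ 2 := not_mem_sq_of_span_pair' hdim hm
  haveI := isPrime_span_singleton_of_not_mem_sq hf hf2
  haveI := isDiscreteValuationRing_quotient_span_singleton hdim hf hf2
  have hirr := irreducible_mk_of_span_pair hdim hm
  set π := Ideal.Quotient.mk (Ideal.span {f}) with hπ
  have hg0 : π g ≠ 0 := by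
    rwa [Ne, Ideal.Quotient.eq_zero_iff_mem, Ideal.mem_span_singleton]
  obtain ⟨n, v, hv⟩ := IsDiscreteValuationRing.eq_unit_mul_pow_irreducible hg0 hirr
  obtain ⟨u, hu⟩ := Ideal.Quotient.mk_surjective (I := Ideal.span {f}) (v : R ⧸ Ideal.span {f})
  haveI : Nontrivial (R ⧸ Ideal.span {f}) := inferInstance
  haveI := IsLocalHom.of_surjective π Ideal.Quotient.mk_surjective
  have huu : IsUnit u := (isUnit_map_iff π u).mp (by rw [← hπ] at hu; rw [hu]; exact v.isUnit)
  have hdiff : g - u * x ^ n ∈ Ideal.span {f} := by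
    rw [← Ideal.Quotient.eq_zero_iff_mem, map_sub, map_mul, map_pow]
    change π g - π u * π x ^ n = 0
    rw [hu, hv, sub_self]
  obtain ⟨h, hh⟩ := Ideal.mem_span_singleton'.mp hdiff
  refine ⟨n, u, h, huu, by rw [mul_comm f h, hh]; ring, ?_⟩
  have e : g = u * x ^ n + f * h := by rw [mul_comm f h, hh]; ring
  rw [e]
  exact length_quotient_span_pair_unit_mul_pow_add hdim hm huu n h

/-- **(I2) transversality.** With `𝔪 = (x, f)` and `f ∤ g`: `λ(R/(f, g)) = 1 ↔ (f, g) = 𝔪`; and in the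
normal form `g = u xⁿ + f h` this is `n = 1`. (Instance of `length_quotient_eq_one_iff`.) [folklore] -/
theorem length_quotient_span_pair_eq_one_iff (f g : R) :
    Module.length R (R ⧸ Ideal.span {f, g}) = 1 ↔ Ideal.span {f, g} = maximalIdeal R :=
  length_quotient_eq_one_iff _

/-- `λ(R/(f, g)) ≥ 1 ↔ g ∈ 𝔪` for `f ∈ 𝔪`. [folklore] -/
theorem one_le_length_quotient_span_pair_iff {f : R} (hf : f ∈ maximalIdeal R) (g : R) :
    1 ≤ Module.length R (R ⧸ Ideal.span {f, g}) ↔ g ∈ maximalIdeal R := by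
  rw [one_le_length_quotient_iff, Ideal.span_le]
  constructor
  · intro h; exact h (by simp)
  · rintro hg z (rfl | rfl)
    · exact hf
    · simpa using hg

end IntersectionNumber

/-! ## Any two branches without common component: the intersection number is finite -/

section General

variable {R : Type u} [CommRing R]

/-- In a Noetherian local ring, `R/𝔪ᴺ` has finite length (it is an Artinian local ring). [folklore] -/
theorem length_quotient_pow_maximalIdeal_ne_top [IsNoetherianRing R] [IsLocalRing R] (N : ℕ) :
    Module.length R (R ⧸ maximalIdeal R ^ N) ≠ ⊤ := by
  by_cases hN : maximalIdeal R ^ N = ⊤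
  · haveI : Subsingleton (R ⧸ maximalIdeal R ^ N) := Ideal.Quotient.subsingleton_iff.mpr hN
    rw [Module.length_eq_zero]; exact ENat.zero_ne_top
  haveI : Nontrivial (R ⧸ maximalIdeal R ^ N) := Ideal.Quotient.nontrivial_iff.mpr hN
  haveI := IsLocalRing.of_surjective' (Ideal.Quotient.mk (maximalIdeal R ^ N)) Ideal.Quotient.mk_surjective
  haveI : IsArtinianRing (R ⧸ maximalIdeal R ^ N) := by
    rw [isArtinianRing_iff_isNilpotent_maximalIdeal]
    refine ⟨N, ?_⟩
    rw [maximalIdeal_quotient_eq_map (maximalIdeal R ^ N), ← Ideal.map_pow, Ideal.zero_eq_bot,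
      Ideal.map_quotient_self]
  have hsurj : Function.Surjective (algebraMap R (R ⧸ maximalIdeal R ^ N)) := by
    rw [Ideal.Quotient.algebraMap_eq]; exact Ideal.Quotient.mk_surjective
  rw [Module.length_eq_of_surjective (S := R) (R := R ⧸ maximalIdeal R ^ N) hsurj]
  exact Module.length_ne_top

/-- **(I1) for two arbitrary branches.** In a two-dimensional regular local ring two relatively prime
elements `p, q` (e.g. generators of two DISTINCT height-one primes) span an `𝔪`-primary ideal, so
`λ(R/(p, q)) < ∞`. [cite: Matsumura1987, Thm. 20.3 (dimension two)] -/
theorem length_quotient_span_pair_ne_top_of_isRelPrime [IsRegularLocalRing R]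
    (hdim : ringKrullDim R = 2) {p q : R} (hpq : IsRelPrime p q) :
    Module.length R (R ⧸ Ideal.span {p, q}) ≠ ⊤ := by
  obtain ⟨N, hN⟩ := exists_pow_maximalIdeal_le_span_pair hdim hpq
  have hsurj : Function.Surjective
      (Submodule.mapQ (maximalIdeal R ^ N) (Ideal.span {p, q}) LinearMap.id hN) := by
    rintro ⟨a⟩
    exact ⟨Submodule.Quotient.mk a, rfl⟩
  exact ne_top_of_le_ne_top (length_quotient_pow_maximalIdeal_ne_top N)
    (Module.length_le_of_surjective _ hsurj)

/-- Two non-associated prime elements are relatively prime (so the previous theorem applies to the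
generators of two distinct height-one primes of the factorial ring `R`). [folklore] -/
theorem isRelPrime_of_prime_of_not_associated [IsDomain R] {p q : R} (hp : Prime p) (hq : Prime q)
    (hpq : ¬ Associated p q) : IsRelPrime p q := by
  rw [hp.irreducible.isRelPrime_iff_not_dvd]
  intro hdvd
  exact hpq (hp.irreducible.associated_of_dvd hq.irreducible hdvd)

end General


end CampaignW46

end Summit.ResolutionOfSingularities.ResolutionOfSingularities.Theorems

end
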